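import Summits.QuantumFields.BalabanUV.Beta.FP.NestedStepLawTransported
import Summits.QuantumFields.BalabanUV.Beta.FP.ExponentialTransportJets

/-!
# `BalabanUV.Beta.FP.NestedStepLawTransportedExp` — road «FP» for binder row D1, ROUTE T, presentation T-β: **THE TRANSPORTED ONE-SHOT STEP LAW FOR A
# ONE-PARAMETER-GROUP TRANSPORT** (`NestedStepLawTransported` §2 at the exponential 2-jets of leaf-06's `ExponentialTransportJets`)

WHAT.  `NestedStepLawTransported.secondVar_oneShot_nestedStepLaw_transported_of_letters` (§2 of the previous file) displays general transport 2-jets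
`A A′ Ā` with the letters (T-β-2) `uA uĀ`, (T-β-3) `i0 i1 i2`, `hA hĀ`, and a general parameter transport `C` with `hC`.  When the chart transport is a
ONE-PARAMETER GROUP to second order — fields `exp(uX)` (inverse `exp(−uX)`), composite multipliers `exp(uX̄)`, parameters `C = (1, C₁, C₂)` — these
letters are AUTOMATIC (leaf-06 `ExponentialTransportJets` §1: `expJet_b0∕b1∕b2`, `secondVar_expJet`, `det_expJet₀_ne_zero`), the unit jets erase, and the
law reads (**`secondVar_oneShot_nestedStepLaw_expTransported_of_letters`**): with the one-shot literal's composite first∕second jets NAMED as the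
`X`-conjugated words `𝔎♯₁ = Xᵀ𝔎₀ + 𝔎₁ + 𝔎₀X`, `𝔎♯₂ = (X·X)ᵀ𝔎₀ + 2(Xᵀ𝔎₁ + Xᵀ𝔎₀X) + 𝔎₂ + 2𝔎₁X + 𝔎₀(X·X)` (grouped as in
`SliceTransportConjugation.conj_kkt_second`), `𝔔♯₁ = X̄𝔔₀ + 𝔔₁ + 𝔔₀X`, `𝔔♯₂ = …`, the intertwining letters `j1 : −X·W₀ + W₁ = W♯₁ + W₀·C₁`,
`j2 : X·X·W₀ + 2•(−X·W₁) + W₂ = W♯₂ + 2•(W♯₁·C₁) + W₀·C₂` (`W♯₀ = W₀`: both charts start at the trivial background), `uC : secondVar 1 C₁ C₂ = 0`, and the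
two charts' dead-row letters `p1 p2 s1 s2 t1 t2`:

  `secondVar (kkt 𝔎₀ [𝔔₀; P]) (kkt 𝔎♯₁ [𝔔♯₁; 0]) (kkt 𝔎♯₂ [𝔔♯₂; 0]) = fine one-step sliced (static τ₁) + coarse sliced` — EXACTLY (p308750's right-hand
  side without the Faddeev–Popov pair).

[folklore] one `exact` of the previous file at the exponential jets; no `def`, no `def … : Prop`, nothing cited, 0 sorry.  What `X X̄ C₁ C₂ W♯₁ W♯₂` ARE for the
literal (the colour-stripped shadow of `Ad(exp(u·ψ_b))`, `ψ_b = λ_nest(e_b) − λ_big(e_b)`, and of its action on multipliers ∕ gauge parameters) and the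
table identities `k* q* j* p* s* t* a* b*` are the dictionary's (leaf-02 ∕ leaf-06 ∕ an2), displayed as hypotheses.

HONEST DEPENDENCY (page 1, mandatory): continuum YM on T⁴ ⇐ BetaPertH ∧ nine spine estimates (0/9 proved); BetaPertH ⇐ (D1) ∧ (D4) ∧ CAP+tail;
G-an2-4 gates asym, D1 and NE2/3/4.  HONEST FRAMING (cell contract, verbatim): «discharging `BetaPertH` makes Bałaban's UV stability UNCONDITIONAL —
a real constructive-QFT result; it is NOT the continuum limit and NOT the Clay problem.»  ABSOLUTE RULE (cell charter, verbatim): «No internally-minted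
statement may enter as a cited fact. Every hypothesis is either kernel-proved in this package or a verbatim quotation of a PUBLISHED theorem with page
reference. The manuscript(s) under audit are NOT citable for their own disputed steps — they are the thing under adjudication; programme-internal
(2001/route/tribunal) claims are never citable.»  0∕4 row-D1 binders; NOT (T-ID), NOT SDF, NOT D1, NOT BetaPertH, NOT continuum, NOT Clay.
Road «FP» OWNER, b2b-balaban-beta-d1-p3 gen 18, 2026-08-22.  No existing file touched.
-/

noncomputable section

namespace Summit.QuantumFields.BalabanUV.Beta.FP.NestedStepLawTransportedExp

open Matrix Finset
open Literature.MathematicalPhysics.QuantumFieldTheory.Balaban1983to89.Beta.Composition (kkt)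
open Literature.MathematicalPhysics.QuantumFieldTheory.Balaban1983to89.Beta.CompositionSingular (effForm flucCov minOp minOpL)
open Summit.QuantumFields.BalabanUV.Beta.D1BFx.LogDetSecondVariation (secondVar)
open Summit.QuantumFields.BalabanUV.Beta.FP.NestedStepLawTransported (secondVar_oneShot_nestedStepLaw_transported_of_letters)
open Summit.QuantumFields.BalabanUV.Beta.FP.ExponentialTransportJets (expJet_b0 expJet_b1 expJet_b2 secondVar_expJet det_expJet₀_ne_zero)

variable {ν μ κ ρ₁ ρ₂ : Type*} [Fintype ν] [Fintype μ] [Fintype κ] [Fintype ρ₁] [Fintype ρ₂]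
  [DecidableEq ν] [DecidableEq μ] [DecidableEq κ] [DecidableEq ρ₁] [DecidableEq ρ₂]

/-- [folklore] **THE ONE-SHOT-SLICED COMPOSITE STEP LAW, TRANSPORT FIRST, FOR A ONE-PARAMETER-GROUP TRANSPORT: ZERO DEFECT.**  Data and letters of
`NestedStepLawOneShotJets.secondVar_oneShot_nestedStepLaw_jets` (p308750) in the NESTED chart; transport generators `X` (fields), `X̄` (composite
multipliers); the one-shot literal's composite jets `𝔎♯₁ 𝔎♯₂ 𝔔♯₁ 𝔔♯₂` NAMED as the `X`-conjugated words (T-β-1); the one-shot chart's generator jets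
`W♯₁ W♯₂` and parameter-transport jets `C₁ C₂` with the intertwining letters `j1 j2` (T-β-4) and `secondVar 1 C₁ C₂ = 0`; dead-row letters of both charts.
CONCLUSION: `secondVar (kkt 𝔎₀ [𝔔₀;P]) (kkt 𝔎♯₁ [𝔔♯₁;0]) (kkt 𝔎♯₂ [𝔔♯₂;0]) =` fine one-step sliced `+` coarse sliced (p308750's words), no defect. -/
theorem secondVar_oneShot_nestedStepLaw_expTransported_of_letters
    (H₀ H₁ H₂ : Matrix ν ν ℝ) (Q₁₀ Q₁₁ Q₁₂ : Matrix μ ν ℝ) (Q₂₀ Q₂₁ Q₂₂ : Matrix κ μ ℝ) (G₀ G₁ G₂ : Matrix μ μ ℝ)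
    (τ₁ : Matrix ρ₁ ν ℝ) (τ₂ : Matrix ρ₂ μ ℝ) (P : Matrix (ρ₂ ⊕ ρ₁) ν ℝ) (W₀ W₁ W₂ : Matrix ν (ρ₂ ⊕ ρ₁) ℝ) (Y₀ Y₁ Y₂ Y'₀ Y'₁ Y'₂ : Matrix κ (ρ₂ ⊕ ρ₁) ℝ)
    -- the transport generators (fields, composite multipliers), the one-shot chart's generator jets and the parameter-transport jets
    (X : Matrix ν ν ℝ) (Xbar : Matrix κ κ ℝ) (W'₁ W'₂ : Matrix ν (ρ₂ ⊕ ρ₁) ℝ) (C₁ C₂ : Matrix (ρ₂ ⊕ ρ₁) (ρ₂ ⊕ ρ₁) ℝ)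
    {𝔎₀ 𝔎₁ 𝔎₂ : Matrix ν ν ℝ} {𝔔₀ 𝔔₁ 𝔔₂ : Matrix κ ν ℝ}
    (h𝔎₀ : H₀ + Q₁₀ᵀ * G₀ * Q₁₀ = 𝔎₀) (h𝔎₁ : H₁ + (Q₁₁ᵀ * G₀ * Q₁₀ + Q₁₀ᵀ * G₁ * Q₁₀ + Q₁₀ᵀ * G₀ * Q₁₁) = 𝔎₁)
    (h𝔎₂ : H₂ + ((Q₁₂ᵀ * G₀ * Q₁₀ + Q₁₁ᵀ * G₁ * Q₁₀ + Q₁₁ᵀ * G₀ * Q₁₁) + (Q₁₁ᵀ * G₁ * Q₁₀ + Q₁₀ᵀ * G₂ * Q₁₀ + Q₁₀ᵀ * G₁ * Q₁₁)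
            + (Q₁₁ᵀ * G₀ * Q₁₁ + Q₁₀ᵀ * G₁ * Q₁₁ + Q₁₀ᵀ * G₀ * Q₁₂)) = 𝔎₂)
    (h𝔔₀ : Q₂₀ * Q₁₀ = 𝔔₀) (h𝔔₁ : Q₂₁ * Q₁₀ + Q₂₀ * Q₁₁ = 𝔔₁) (h𝔔₂ : Q₂₂ * Q₁₀ + Q₂₁ * Q₁₁ + (Q₂₁ * Q₁₁ + Q₂₀ * Q₁₂) = 𝔔₂)
    -- (T-β-1) for the exponential transport: the one-shot literal's composite jets are the `X`-conjugated words, NAMED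
    {𝔎'₁ 𝔎'₂ : Matrix ν ν ℝ} {𝔔'₁ 𝔔'₂ : Matrix κ ν ℝ}
    (k1 : Xᵀ * 𝔎₀ + 𝔎₁ + 𝔎₀ * X = 𝔎'₁)
    (k2 : (X * X)ᵀ * 𝔎₀ + (Xᵀ * 𝔎₁ + Xᵀ * 𝔎₀ * X) + ((Xᵀ * 𝔎₁ + Xᵀ * 𝔎₀ * X) + (𝔎₂ + 𝔎₁ * X + (𝔎₁ * X + 𝔎₀ * (X * X)))) = 𝔎'₂)
    (q1 : Xbar * 𝔔₀ + 𝔔₁ + 𝔔₀ * X = 𝔔'₁)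
    (q2 : Xbar * Xbar * 𝔔₀ + (Xbar * 𝔔₁ + Xbar * 𝔔₀ * X) + ((Xbar * 𝔔₁ + Xbar * 𝔔₀ * X) + (𝔔₂ + 𝔔₁ * X + (𝔔₁ * X + 𝔔₀ * (X * X)))) = 𝔔'₂)
    -- (T-β-4) intertwining (inverse field transport `(1, −X, X·X)`; `W♯₀ = W₀`, `C₀ = 1`) and unimodularity of the parameter transport
    (j1 : -X * W₀ + W₁ = W'₁ + W₀ * C₁) (j2 : X * X * W₀ + (2 : ℝ) • (-X * W₁) + W₂ = W'₂ + (2 : ℝ) • (W'₁ * C₁) + W₀ * C₂)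
    (uC : secondVar (1 : Matrix (ρ₂ ⊕ ρ₁) (ρ₂ ⊕ ρ₁) ℝ) C₁ C₂ = 0)
    -- dead rows: the one-shot slice along the one-shot family; the nested slice along the nested family
    (p1 : P * W'₁ = 0) (p2 : P * W'₂ = 0)
    (s1 : τ₁ * W₁ = 0) (s2 : τ₁ * W₂ = 0) (t1 : τ₂ * (Q₁₁ * W₀ + Q₁₀ * W₁) = 0) (t2 : τ₂ * (Q₁₂ * W₀ + (2 : ℝ) • (Q₁₁ * W₁) + Q₁₀ * W₂) = 0)
    -- Ward letters of the composite system to second order at `0`, NESTED chart (as p308750)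
    (a0 : 𝔎₀ * W₀ = 𝔔₀ᵀ * Y₀) (a1 : 𝔎₁ * W₀ + 𝔎₀ * W₁ = 𝔔₁ᵀ * Y₀ + 𝔔₀ᵀ * Y₁)
    (a2 : 𝔎₂ * W₀ + (2 : ℝ) • (𝔎₁ * W₁) + 𝔎₀ * W₂ = 𝔔₂ᵀ * Y₀ + (2 : ℝ) • (𝔔₁ᵀ * Y₁) + 𝔔₀ᵀ * Y₂)
    (a0t : 𝔎₀ᵀ * W₀ = 𝔔₀ᵀ * Y'₀) (a1t : 𝔎₁ᵀ * W₀ + 𝔎₀ᵀ * W₁ = 𝔔₁ᵀ * Y'₀ + 𝔔₀ᵀ * Y'₁)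
    (a2t : 𝔎₂ᵀ * W₀ + (2 : ℝ) • (𝔎₁ᵀ * W₁) + 𝔎₀ᵀ * W₂ = 𝔔₂ᵀ * Y'₀ + (2 : ℝ) • (𝔔₁ᵀ * Y'₁) + 𝔔₀ᵀ * Y'₂)
    (b0 : 𝔔₀ * W₀ = 0) (b1 : 𝔔₁ * W₀ + 𝔔₀ * W₁ = 0) (b2 : 𝔔₂ * W₀ + (2 : ℝ) • (𝔔₁ * W₁) + 𝔔₀ * W₂ = 0)
    (hPW : (P * W₀).det ≠ 0) (hTW : (fromRows (τ₂ * Q₁₀) τ₁ * W₀).det ≠ 0)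
    {Γ : Matrix ν ν ℝ} {I : Matrix ν (μ ⊕ ρ₁) ℝ} {L : Matrix (μ ⊕ ρ₁) ν ℝ} {S : Matrix (μ ⊕ ρ₁) (μ ⊕ ρ₁) ℝ} {B : Matrix (μ ⊕ ρ₁) ν ℝ}
    (hΓ : flucCov H₀ (fromRows Q₁₀ τ₁) = Γ) (hI : minOp H₀ (fromRows Q₁₀ τ₁) = I) (hL : minOpL H₀ (fromRows Q₁₀ τ₁) = L) (hS : effForm H₀ (fromRows Q₁₀ τ₁) = S)
    (hB : fromRows Q₁₁ (0 : Matrix ρ₁ ν ℝ) = B)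
    (h1 : (kkt H₀ (fromRows Q₁₀ τ₁)).det ≠ 0)
    (h2 : (kkt (S.toBlocks₁₁ + G₀) (fromRows Q₂₀ τ₂)).det ≠ 0) :
    secondVar (kkt 𝔎₀ (fromRows 𝔔₀ P)) (kkt 𝔎'₁ (fromRows 𝔔'₁ (0 : Matrix (ρ₂ ⊕ ρ₁) ν ℝ))) (kkt 𝔎'₂ (fromRows 𝔔'₂ (0 : Matrix (ρ₂ ⊕ ρ₁) ν ℝ)))
      = secondVar (kkt H₀ (fromRows Q₁₀ τ₁)) (kkt H₁ B) (kkt H₂ (fromRows Q₁₂ (0 : Matrix ρ₁ ν ℝ)))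
        + secondVar
            (kkt (S.toBlocks₁₁ + G₀) (fromRows Q₂₀ τ₂))
            (kkt (((L * H₁ - S * B) * I - L * Bᵀ * S).toBlocks₁₁ + G₁) (fromRows Q₂₁ (0 : Matrix ρ₂ μ ℝ)))
            (kkt ((((-((L * H₁ - S * B) * Γ + L * Bᵀ * L) * H₁ + L * H₂
                      - (((L * H₁ - S * B) * I - L * Bᵀ * S) * B + S * fromRows Q₁₂ (0 : Matrix ρ₁ ν ℝ))) * I
                    + (L * H₁ - S * B) * (-((Γ * H₁ + I * B) * I - Γ * Bᵀ * S)))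
                  - ((-((L * H₁ - S * B) * Γ + L * Bᵀ * L) * Bᵀ + L * (fromRows Q₁₂ (0 : Matrix ρ₁ ν ℝ))ᵀ) * S
                      + L * Bᵀ * ((L * H₁ - S * B) * I - L * Bᵀ * S))).toBlocks₁₁ + G₂)
              (fromRows Q₂₂ (0 : Matrix ρ₂ μ ℝ))) := by
  -- the exponential jets: `A = (1, X, X·X)`, `A′ = (1, −X, X·X)`, `Ā = (1, X̄, X̄·X̄)`, `C = (1, C₁, C₂)`, `W♯₀ = W₀`; unit jets erased in the letters
  have k0 : (1 : Matrix ν ν ℝ)ᵀ * 𝔎₀ * (1 : Matrix ν ν ℝ) = 𝔎₀ := by rw [Matrix.transpose_one, Matrix.one_mul, Matrix.mul_one]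
  have k1' : Xᵀ * 𝔎₀ * (1 : Matrix ν ν ℝ) + (1 : Matrix ν ν ℝ)ᵀ * 𝔎₁ * (1 : Matrix ν ν ℝ) + (1 : Matrix ν ν ℝ)ᵀ * 𝔎₀ * X = 𝔎'₁ := by
    simpa only [Matrix.transpose_one, Matrix.one_mul, Matrix.mul_one] using k1
  have k2' : (X * X)ᵀ * 𝔎₀ * (1 : Matrix ν ν ℝ) + (Xᵀ * 𝔎₁ * (1 : Matrix ν ν ℝ) + Xᵀ * 𝔎₀ * X)
      + ((Xᵀ * 𝔎₁ * (1 : Matrix ν ν ℝ) + Xᵀ * 𝔎₀ * X)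
        + ((1 : Matrix ν ν ℝ)ᵀ * 𝔎₂ * (1 : Matrix ν ν ℝ) + (1 : Matrix ν ν ℝ)ᵀ * 𝔎₁ * X + ((1 : Matrix ν ν ℝ)ᵀ * 𝔎₁ * X + (1 : Matrix ν ν ℝ)ᵀ * 𝔎₀ * (X * X)))) = 𝔎'₂ := by
    simpa only [Matrix.transpose_one, Matrix.one_mul, Matrix.mul_one] using k2
  have q0 : (1 : Matrix κ κ ℝ) * 𝔔₀ * (1 : Matrix ν ν ℝ) = 𝔔₀ := by rw [Matrix.one_mul, Matrix.mul_one]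
  have q1' : Xbar * 𝔔₀ * (1 : Matrix ν ν ℝ) + (1 : Matrix κ κ ℝ) * 𝔔₁ * (1 : Matrix ν ν ℝ) + (1 : Matrix κ κ ℝ) * 𝔔₀ * X = 𝔔'₁ := by
    simpa only [Matrix.one_mul, Matrix.mul_one] using q1
  have q2' : Xbar * Xbar * 𝔔₀ * (1 : Matrix ν ν ℝ) + (Xbar * 𝔔₁ * (1 : Matrix ν ν ℝ) + Xbar * 𝔔₀ * X)
      + ((Xbar * 𝔔₁ * (1 : Matrix ν ν ℝ) + Xbar * 𝔔₀ * X)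
        + ((1 : Matrix κ κ ℝ) * 𝔔₂ * (1 : Matrix ν ν ℝ) + (1 : Matrix κ κ ℝ) * 𝔔₁ * X + ((1 : Matrix κ κ ℝ) * 𝔔₁ * X + (1 : Matrix κ κ ℝ) * 𝔔₀ * (X * X)))) = 𝔔'₂ := by
    simpa only [Matrix.one_mul, Matrix.mul_one] using q2
  have j0 : (1 : Matrix ν ν ℝ) * W₀ = W₀ * (1 : Matrix (ρ₂ ⊕ ρ₁) (ρ₂ ⊕ ρ₁) ℝ) := by rw [Matrix.one_mul, Matrix.mul_one]
  have j1' : -X * W₀ + (1 : Matrix ν ν ℝ) * W₁ = W'₁ * (1 : Matrix (ρ₂ ⊕ ρ₁) (ρ₂ ⊕ ρ₁) ℝ) + W₀ * C₁ := by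
    simpa only [Matrix.one_mul, Matrix.mul_one] using j1
  have j2' : X * X * W₀ + (2 : ℝ) • (-X * W₁) + (1 : Matrix ν ν ℝ) * W₂ = W'₂ * (1 : Matrix (ρ₂ ⊕ ρ₁) (ρ₂ ⊕ ρ₁) ℝ) + (2 : ℝ) • (W'₁ * C₁) + W₀ * C₂ := by
    simpa only [Matrix.one_mul, Matrix.mul_one] using j2
  exact secondVar_oneShot_nestedStepLaw_transported_of_letters H₀ H₁ H₂ Q₁₀ Q₁₁ Q₁₂ Q₂₀ Q₂₁ Q₂₂ G₀ G₁ G₂ τ₁ τ₂ P W₀ W₁ W₂ Y₀ Y₁ Y₂ Y'₀ Y'₁ Y'₂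
    (1 : Matrix ν ν ℝ) X (X * X) (1 : Matrix ν ν ℝ) (-X) (X * X) (1 : Matrix κ κ ℝ) Xbar (Xbar * Xbar) W₀ W'₁ W'₂ (1 : Matrix (ρ₂ ⊕ ρ₁) (ρ₂ ⊕ ρ₁) ℝ) C₁ C₂
    h𝔎₀ h𝔎₁ h𝔎₂ h𝔔₀ h𝔔₁ h𝔔₂ k0 k1' k2' q0 q1' q2' det_expJet₀_ne_zero det_expJet₀_ne_zero expJet_b0 (expJet_b1 X) (expJet_b2 X)
    (secondVar_expJet X) (secondVar_expJet Xbar) j0 j1' j2' det_expJet₀_ne_zero uC p1 p2 s1 s2 t1 t2 a0 a1 a2 a0t a1t a2t b0 b1 b2 hPW hTW hPW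
    hΓ hI hL hS hB h1 h2

end Summit.QuantumFields.BalabanUV.Beta.FP.NestedStepLawTransportedExp

end
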